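import Summits.BirchSwinnertonDyer.Rank1Residual.X2.LocalInertiaCohomologyMultiplicativeVanishing
import Summits.BirchSwinnertonDyer.BirchSwinnertonDyer.Theorems.EisensteinPrimesInertiaTorsionCardGeneric
import Summits.BirchSwinnertonDyer.BirchSwinnertonDyer.Theorems.EisensteinPrimesUnrSelmerQuotientTorsionFiniteChar
import Literature.NumberTheory.GaloisRepresentations.InertiaHomFrobeniusTwist
import Literature.NumberTheory.GaloisRepresentations.FrobeniusPrimeToPPart
import Literature.NumberTheory.GaloisRepresentations.ContinuousH1TrivialAction
import Literature.NumberTheory.EllipticCurves.KellerYin2024.CharacterModulePrufer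
import HarnessLib

/-!
# Local lemmas for the character module `(F/𝒪)(θ)` at a place `w ∤ p`: the RESIDUALLY RAMIFIED
# vanishing (`c_w = 0`), and the Frobenius / prime-to-`p`-part lemmas for the unramified case
# (Keller–Yin / CGLS Lemma 1.1.1, Greenberg–Vatsal Prop. (2.4): the case `λ(𝒫_w(θ)) = 0`) — KERNEL, part 1

Cell `bsd-eis`, seat `bsd-line-x1-p1` (LEAD, D-0154 row 4), crux 2 `GoodLatticeBDPValue`
(stmt-BirchSwinnertonDyer-19032), line `halves` v14, stub `stub_imprimCorank` (`≤` half of the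
`S`-relaxation corank identity `prop125_residualPair_unrSelmer_corank`). Tool theorems only (no
definition, no named fact, no `sorry`).

For a number field `K`, a prime `p`, a character `θ : Γ_K → GL₁(𝓞)` (`𝓞 = 𝒪_{ℚ_p(∅)} ≅ ℤ_p`; its
`ℤ_p`-valued avatar is the tree's `unitChar θ`, and `(F/𝒪)(θ) ≃ ℚ_p/ℤ_p(unitChar θ)`
`Γ_K`-equivariantly, `charModuleEquiv_galois_smul`), a place `w ∤ p` and a subgroup `H ≤ Γ_K` containing
`I_w` — the per-place corank bound `c_w = 0` of `DatumSelmerQuotientCorankGeneric.zpCorank_quotient_le_sum`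
in the two cases where KY's `λ(𝒫_w(θ)) = [Γ:Γ_w]·𝟙[θ unramified at w ∧ θ(Frob_w) ≡ Nw]` vanishes:

* §1 (RESIDUALLY RAMIFIED) `torsionBy_charModule_eq_zero_of_inertia_ne` — if some `σ ∈ I_{K_w}` has
  `θ(σ) ≢ 1 (mod p)` then `((F/𝒪)(θ)[p])^{I_{K_w}} = 0`; hence (`InertiaTorsionCardGeneric`) every
  subgroup of `H¹(inertiaIn H w, (F/𝒪)(θ))` has `zpCorank = 0` (`zpCorank_eq_zero_of_inertia_ne`).
* §2 (local lemmas for the UNRAMIFIED case, used by the sequel `EisensteinPrimesCharLocalVanishing`):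
  `apply_conj_eq_nsmul_of_mapClusterPt` — a continuous homomorphism `f : I_F → B` into a finite
  `p`-torsion group is multiplied by `q` under conjugation by the prime-to-`p` part `g` of a Frobenius
  (a cluster point of `φ^{p^{k!}}`; Serre 1972 §1.8 via the tree's `apply_frob_conj_eq_card_nsmul`,
  iterated, `q^{p^{k!}} ≡ q (mod p)`, closed condition); `isUnit_sub_of_mapClusterPt` — `u(g) ≡ u(φ)
  (mod p)` for a continuous `ℤ_p`-valued `u` multiplicative on powers of `φ`.

References: [GreenbergVatsal2000] §2 Prop. (2.4) pp. 22–23; [KellerYin2024] Lemma 1.1.1 (arXiv:2402.12781v2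
TeX L455–462); [CastellaGrossiLeeSkinner2022] Lemma 1.1.1; [SerreInventiones1972] §1.8 Prop. 6.
-/

set_option linter.dupNamespace false
set_option autoImplicit false

noncomputable section

open scoped Classical NNReal AddSubgroup

open CategoryTheory Function Filter NumberField IsDedekindDomain Field ValuativeRel
open Literature.NumberTheory.EllipticCurves Literature.NumberTheory.EllipticCurves.GreenbergSelmer
  Literature.NumberTheory.GaloisRepresentations
  Literature.NumberTheory.GaloisRepresentations.IsNonarchimedeanLocalField
  Literature.NumberTheory.EllipticCurves.KellerYin2024 Literature.NumberTheory.IwasawaTheory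
  IsDedekindDomain.HeightOneSpectrum
open Summit.BirchSwinnertonDyer.Rank1Residual
  Summit.BirchSwinnertonDyer.Rank1Residual.X2.NonPrimitiveQuotientCorank
  Summit.BirchSwinnertonDyer.BirchSwinnertonDyer.Theorems.IwasawaTwoVariable
  Summit.BirchSwinnertonDyer.BirchSwinnertonDyer.Theorems.UnrSelmerQuotientTorsionFiniteChar
  Summit.BirchSwinnertonDyer.BirchSwinnertonDyer.Theorems.InertiaTorsionCardGeneric

namespace Summit.BirchSwinnertonDyer.BirchSwinnertonDyer.Theorems.CharLocalVanishing

variable {K : Type} [Field K] [NumberField K] {p : ℕ} [hp : Fact p.Prime]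
  (θ : FramedGaloisRep K (padicCoeffIntegers (∅ : Set (PadicAlgCl p))) 1)
  {v : HeightOneSpectrum (𝓞 K)}

/-! ## §0. The Galois action on `(F/𝒪)(θ)` is the scalar action of `unitChar θ` -/

/-- `σ • a` read through `charModuleEquiv`: a unit `u` with `u - 1` a unit of `ℤ_p` fixes no non-zero
element of `ℚ_p/ℤ_p`. [folklore] -/
theorem eq_zero_of_unit_sub_smul_eq {u c : ℤ_[p]} (hu : IsUnit (u - c)) {x : QpModZp p}
    (hx : u • x = c • x) : x = 0 := by
  obtain ⟨w, hw⟩ := hu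
  have h0 : (u - c) • x = 0 := by rw [sub_smul, hx, sub_self]
  rw [← hw] at h0
  have h1 := congrArg (fun y ↦ ((w⁻¹ : ℤ_[p]ˣ) : ℤ_[p]) • y) h0
  simp only [smul_smul, Units.inv_mul, one_smul, smul_zero] at h1
  exact h1

omit [NumberField K] in
/-- Trivial Galois action where `unitChar θ = 1`: `σ • a = a`. [cite: KellerYin2024, §1.1 (arXiv:2402.12781v2 TeX L441–449)] -/
theorem smul_eq_self_of_unitChar_eq_one {σ : absoluteGaloisGroup K} (hσ : unitChar θ σ = 1)
    (a : charModule (∅ : Set (PadicAlgCl p)) θ) : σ • a = a := by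
  apply (charModuleEquiv θ).injective
  rw [charModuleEquiv_galois_smul, hσ, Units.val_one, one_smul]

/-! ## §1. Residually ramified `θ`: no inertia-fixed `p`-torsion, `c_w = 0` -/

/-- **`((F/𝒪)(θ)[p])^{I_{K_w}} = 0` when some `σ ∈ I_{K_w}` has `θ(σ) ≢ 1 (mod p)`** (i.e.
`unitChar θ (res σ) - 1` is a unit of `ℤ_p`): `σ` acts on `(F/𝒪)(θ) ≃ ℚ_p/ℤ_p` by the unit `θ(σ)`.
KY Lemma 1.1.1 / GV Prop. (2.4), ramified case (`F(θ)_{I_w} = 0`, `𝒫_w(θ) = 1`).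
[cite: KellerYin2024, Lemma 1.1.1 (arXiv:2402.12781v2 TeX L455–462)] [cite: GreenbergVatsal2000, §2 Prop. (2.4) pp. 22–23] -/
theorem torsionBy_charModule_eq_zero_of_inertia_ne {σ₀ : absoluteGaloisGroup (v.adicCompletion K)}
    (hσ₀ : σ₀ ∈ absInertia (v.adicCompletion K))
    (hu : IsUnit (((unitChar θ (absGaloisRestrict K (v.adicCompletion K) σ₀) : ℤ_[p]ˣ) : ℤ_[p]) - 1))
    (b : ↥((charModule (∅ : Set (PadicAlgCl p)) θ)[(p : ℤ)]))
    (hb : ∀ σ : absoluteGaloisGroup (v.adicCompletion K), σ ∈ absInertia (v.adicCompletion K) →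
      absGaloisRestrict K (v.adicCompletion K) σ • b = b) : b = 0 := by
  have h := congrArg (fun x : ↥((charModule (∅ : Set (PadicAlgCl p)) θ)[(p : ℤ)]) ↦
    charModuleEquiv θ (x : charModule (∅ : Set (PadicAlgCl p)) θ)) (hb σ₀ hσ₀)
  simp only [AddSubgroup.torsionBy.coe_smul, charModuleEquiv_galois_smul] at h
  have h1 : charModuleEquiv θ (b : charModule (∅ : Set (PadicAlgCl p)) θ) = 0 :=
    eq_zero_of_unit_sub_smul_eq (c := 1) hu (by rw [one_smul]; exact h)
  exact Subtype.ext ((charModuleEquiv θ).map_eq_zero_iff.mp h1)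

/-- **`c_w = 0` at a residually ramified place**: for `H = ker κ` (any `ℤ_p`-extension `κ`), `w ∤ p`,
and some `σ ∈ I_{K_w}` with `θ(σ) ≢ 1 (mod p)`, EVERY subgroup `Y ≤ H¹(inertiaIn H w, (F/𝒪)(θ))` has
`zpCorank Y p = 0` (`InertiaTorsionCardGeneric.zpCorank_eq_zero_of_invariants_trivial`).
[cite: KellerYin2024, Lemma 1.1.1 (arXiv:2402.12781v2 TeX L455–462)] [cite: GreenbergVatsal2000, §2 Prop. (2.4) pp. 22–23] -/
theorem zpCorank_eq_zero_of_inertia_ne (κ : ZpExtension K p)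
    (hpv : (p : 𝓞 K) ∉ v.asIdeal) {σ₀ : absoluteGaloisGroup (v.adicCompletion K)}
    (hσ₀ : σ₀ ∈ absInertia (v.adicCompletion K))
    (hu : IsUnit (((unitChar θ (absGaloisRestrict K (v.adicCompletion K) σ₀) : ℤ_[p]ˣ) : ℤ_[p]) - 1))
    (Y : AddSubgroup (discreteH1 (inertiaIn κ.kerSubgroup v) (charModule (∅ : Set (PadicAlgCl p)) θ))) :
    zpCorank Y p = 0 := by
  haveI := finite_torsionBy_charModule (p := p) θ
  exact zpCorank_eq_zero_of_invariants_trivial κ v (M := charModule (∅ : Set (PadicAlgCl p)) θ)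
    ⟨1, by rw [natCard_torsionBy_charModule, pow_one]⟩ (exists_nsmul_eq_charModule θ)
    (isOpen_stabilizer_cofree (∅ : Set (PadicAlgCl p)) θ) hpv
    (fun b hb ↦ torsionBy_charModule_eq_zero_of_inertia_ne θ hσ₀ hu b hb) Y


/-! ## §2. Unramified `θ` with `θ(Frob_w) ≢ Nw (mod p)`: restricted `p`-torsion classes vanish, `c_w = 0` -/

omit hp in
/-- Fermat on `p`-torsion: `q^{p^j} • b = q • b` when `p • b = 0` (`q^{p^j} ≡ q (mod p)`). [folklore] -/
theorem pow_prime_pow_nsmul_eq [Fact p.Prime] {B : Type*} [AddCommGroup B] (q j : ℕ) {b : B}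
    (hb : p • b = 0) : q ^ p ^ j • b = q • b := by
  have hmod : ((q ^ p ^ j : ℕ) : ZMod p) = (q : ZMod p) := by
    rw [Nat.cast_pow, ZMod.pow_card_pow]
  have hle : q ≤ q ^ p ^ j := Nat.le_self_pow (pow_ne_zero _ (Fact.out : p.Prime).ne_zero) q
  have hdvd : p ∣ q ^ p ^ j - q :=
    (Nat.modEq_iff_dvd' hle).mp ((ZMod.natCast_eq_natCast_iff _ _ _).mp hmod).symm
  obtain ⟨t, ht⟩ := hdvd
  have heq : q ^ p ^ j = q + p * t := by omega
  rw [heq, add_smul, mul_comm, mul_smul, hb, smul_zero, add_zero]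

/-- `u^{p^m} ≡ u (mod p)` in `ℤ_p`: `‖u^{p^m} - u‖ ≤ p⁻¹`. [folklore] -/
theorem norm_pow_prime_pow_sub_le (u : ℤ_[p]) (m : ℕ) :
    ‖u ^ p ^ m - u‖ ≤ (p : ℝ) ^ (-(1 : ℕ) : ℤ) := by
  rw [PadicInt.norm_le_pow_iff_mem_span_pow, pow_one, ← PadicInt.maximalIdeal_eq_span_p,
    ← PadicInt.ker_toZMod, RingHom.mem_ker, map_sub, map_pow, ZMod.pow_card_pow, sub_self]

section LocalLemmas

variable (F : Type) [Field F] [ValuativeRel F] [TopologicalSpace F] [IsNonarchimedeanLocalField F]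

omit hp θ in
/-- **The prime-to-`p` part of a Frobenius conjugates tame homomorphisms like `q`.** For a continuous
homomorphism `f : I_F → B` into a finite `p`-torsion group (`p ≠` the residue characteristic), an
arithmetic Frobenius `φ` and a cluster point `g` of `φ^{p^{k!}}`: `f(gσg⁻¹) = q • f(σ)` (Serre 1972 §1.8:
`f(φσφ⁻¹) = q • f(σ)`, iterated, `q^{p^{k!}} ≡ q (mod p)`, and the condition is closed in `φ`).
[cite: SerreInventiones1972, §1.8 Prop. 6] [cite: GreenbergVatsal2000, §2 Prop. (2.4) p. 22] -/
theorem apply_conj_eq_nsmul_of_mapClusterPt [Fact p.Prime] {B : Type*} [AddCommGroup B] [Finite B]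
    [TopologicalSpace B] [DiscreteTopology B]
    (hB : (Nat.card B).Coprime (ringChar 𝓀[F]))
    (hBp : ∀ b : B, p • b = 0)
    (f : absInertia F → B) (hf : ∀ x y, f (x * y) = f x + f y) (hfc : Continuous f)
    {φ g : absoluteGaloisGroup F} (hφ : IsAbsArithFrob φ)
    (hg : MapClusterPt g atTop (fun k : ℕ ↦ φ ^ p ^ k.factorial)) (σ : absInertia F) :
    f ⟨g * σ * g⁻¹, (inferInstance : (absInertia F).Normal).conj_mem _ σ.2 g⟩ =
      residueFieldCard F • f σ := by
  set q : ℕ := residueFieldCard F with hq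
  let conjI : absoluteGaloisGroup F → absInertia F → absInertia F := fun x τ ↦
    ⟨x * τ * x⁻¹, (inferInstance : (absInertia F).Normal).conj_mem _ τ.2 x⟩
  have hconj1 : ∀ τ, f (conjI φ τ) = q • f τ := fun τ ↦
    apply_frob_conj_eq_card_nsmul F hB f hf hfc hφ τ
  have hconjn : ∀ (n : ℕ) (τ : absInertia F), f (conjI (φ ^ n) τ) = q ^ n • f τ := by
    intro n
    induction n with
    | zero =>
      intro τ
      have h1 : conjI (φ ^ 0) τ = τ := Subtype.ext (by
        change φ ^ 0 * (τ : absoluteGaloisGroup F) * (φ ^ 0)⁻¹ = τ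
        rw [pow_zero, one_mul, inv_one, mul_one])
      rw [h1, pow_zero, one_smul]
    | succ n ih =>
      intro τ
      have h1 : conjI (φ ^ (n + 1)) τ = conjI φ (conjI (φ ^ n) τ) := Subtype.ext (by
        change φ ^ (n + 1) * (τ : absoluteGaloisGroup F) * (φ ^ (n + 1))⁻¹ =
          φ * (φ ^ n * (τ : absoluteGaloisGroup F) * (φ ^ n)⁻¹) * φ⁻¹
        rw [pow_succ', mul_inv_rev]
        group)
      rw [h1, hconj1, ih, smul_smul, pow_succ']
  have hcont : Continuous fun x : absoluteGaloisGroup F ↦ f (conjI x σ) :=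
    hfc.comp (((continuous_id.mul continuous_const).mul continuous_id.inv).subtype_mk _)
  have hclosed : IsClosed {x : absoluteGaloisGroup F | f (conjI x σ) = q • f σ} :=
    isClosed_eq hcont continuous_const
  exact MapClusterPt.mem_of_isClosed_of_eventually hg hclosed (Eventually.of_forall fun k ↦ by
    change f (conjI (φ ^ p ^ k.factorial) σ) = q • f σ
    rw [hconjn, pow_prime_pow_nsmul_eq q _ (hBp (f σ))])

omit [ValuativeRel F] [TopologicalSpace F] [IsNonarchimedeanLocalField F] hp θ in
/-- **`u(g) - c` is a unit of `ℤ_p` if `u(φ) - c` is**, for a continuous `u : Γ_F → ℤ_p` multiplicative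
in powers of `φ` (`u(φⁿ) = u(φ)ⁿ`) and a cluster point `g` of `φ^{p^{k!}}`: `u(φ)^{p^{k!}} ≡ u(φ) (mod p)`
and the congruence is a closed condition. [folklore] -/
theorem isUnit_sub_of_mapClusterPt [Fact p.Prime] (u : absoluteGaloisGroup F → ℤ_[p]) (hu : Continuous u)
    {φ g : absoluteGaloisGroup F} (hpow : ∀ n : ℕ, u (φ ^ n) = u φ ^ n)
    (hg : MapClusterPt g atTop (fun k : ℕ ↦ φ ^ p ^ k.factorial)) {c : ℤ_[p]}
    (hc : IsUnit (u φ - c)) : IsUnit (u g - c) := by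
  have hp' : Fact p.Prime := inferInstance
  have hclosed : IsClosed {x : absoluteGaloisGroup F | ‖u x - u φ‖ ≤ (p : ℝ) ^ (-(1 : ℕ) : ℤ)} :=
    isClosed_le (continuous_norm.comp (hu.sub continuous_const)) continuous_const
  have hmem : ∀ k : ℕ, φ ^ p ^ k.factorial ∈
      {x : absoluteGaloisGroup F | ‖u x - u φ‖ ≤ (p : ℝ) ^ (-(1 : ℕ) : ℤ)} := fun k ↦ by
    change ‖u (φ ^ p ^ k.factorial) - u φ‖ ≤ _
    rw [hpow]
    exact norm_pow_prime_pow_sub_le (u φ) _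
  have hgmem := MapClusterPt.mem_of_isClosed_of_eventually hg hclosed (Eventually.of_forall hmem)
  have hlt : ‖u g - u φ‖ < 1 := by
    refine lt_of_le_of_lt hgmem ?_
    have hp1 : (1 : ℝ) < p := by exact_mod_cast hp'.out.one_lt
    exact zpow_lt_one_of_neg₀ hp1 (by norm_num)
  have h1 : ‖u φ - c‖ = 1 := PadicInt.isUnit_iff.mp hc
  have hsum : u g - c = (u g - u φ) + (u φ - c) := by ring
  refine PadicInt.isUnit_iff.mpr ?_
  rw [hsum, PadicInt.norm_add_eq_max_of_ne (by rw [h1]; exact hlt.ne), h1]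
  exact max_eq_right hlt.le

end LocalLemmas


end Summit.BirchSwinnertonDyer.BirchSwinnertonDyer.Theorems.CharLocalVanishing

end
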